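import Summits.FinalStateConjecture.FinalStateConjecture.Theorems.NecksCertify.Negative.SeamedExcisionUnbounded
import Summits.FinalStateConjecture.FinalStateConjecture.Theorems.NecksCertify.Negative.NecksCertifyFalseOfEqualVelocityBinaryWitness

/-!
# `NecksCertify` (crux stmt-FinalStateConjecture-13549, route StarvedNecks) — negative side:
# `¬ NecksCertify` modulo a bare comoving pair

Prover seat `prover-line-stmt-FinalStateConjecture-13549-c3-0` (continuation lead c3 of the line
`two-cap-focusing-ledger`), 2026-08-16; realises item (G2) of the generation-3 disprover's design
(`Cruxes/NecksCertify/Disproof.lean` §G, seat `refuter-cdisprove-stmt-FinalStateConjecture-13549-g3-0`,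
never landed).  Sorry-free, axioms `propext`, `Classical.choice`, `Quot.sound`.

NEGATIVE LEMMA MODULO `H′ = ComovingPairWitness` (the crux item stays open; it is HELD on `H′`,
which is the construction it waits for; the planner's repair C′ — pairwise distinct asymptotic
velocities as an antecedent of the crux, kernel-checked in `Cruxes/NecksCertify/Restated.lean` and
spelled out in `Cruxes/NecksCertify/RESTATED.md` — makes the witness miss the restated item).

* `ComovingPairWitness` (`H′`): the landed hypothesis `H = EqualVelocityBinaryWitness` of
  `NecksCertifyFalseOfEqualVelocityBinaryWitness.lean` (p73407) WITHOUT its growth conjunct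
  "all excision radii of the output tend to infinity" — that conjunct is a theorem for every
  seamed output (`excision_tendsto_atTop_of_seamed`, file `SeamedExcisionUnbounded.lean`).  What is
  left is purely kinematic: an admissible datum with a maximal vacuum Cauchy development whose
  exterior carries an honest `C⁴` decomposition (the crux's antecedent, VERBATIM its `Hc`, `Hf`)
  such that every honest-core (`Hc`), seamed (`Sm`, verbatim) `C²` decomposition of that exterior
  has two distinct labels with the same asymptotic four-velocity `Λᵢ∂₀ = Λⱼ∂₀`.
* `comovingPairWitness_of_equalVelocityBinaryWitness : H → H′`.
* `comovingPairWitness_of_not_necksCertify`, `comovingPairWitness_iff_not_necksCertify`: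
  `H′ ↔ ¬ NecksCertify` — `H′` is the weakest possible hypothesis (recorded for honesty about the hold).
* `pairwise_ne_of_seamed` (rev 2): the positive-side reading — every seamed honest-core `C²`
  decomposition has pairwise distinct `Λᵢ∂₀` (clause-wise hypotheses, citeable by seam provers and by
  the planner's restatement G′); `not_comovingPairWitness_of_necksCertify` (rev 2): contrapositive.
* `NecksCertify_false_of_ComovingPairWitness : H′ → ¬ NecksCertify`: apply the crux to the
  honest input of `H′`; the seamed output has `R ≥ R₀' + 4 > −1` (S1 with `R₀' ≥ 100·Mᵢ > 0`),
  a comoving pair `i ≠ j` (by `H′`) and `ρⱼ → ∞` (by (G1) from `Hc`(1), S1, S6, S7, S8, S12 of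
  the output), contradicting `false_of_parallel_boosts_of_tendsto` (S8 + S12).

WHY `H′` IS NOT CONSTRUCTIBLE IN THE TREE (and is physics, not a typing slip): it needs an
admissible datum WITH a maximal vacuum Cauchy development carrying at least one hole
(`VacuumCauchyDevelopment.IsMaximal` is provable for no constructible spacetime of the tree, and in
Minkowski space every honest decomposition has `N = 0`, Disproof §A), and LABEL RIGIDITY for that
development: every honest seamed re-charting of a threshold ("parabolic") two-hole recession
carries two labels with the centre-of-mass velocity (one atlas pins `Λᵢ∂₀` to the physical
asymptotic velocity of hole `i`; `Hf`(3) excludes decoy labels; Disproof §D).  Both are statements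
about two-black-hole MGHDs, which nothing in print constructs.
-/

noncomputable section

open scoped Manifold ContDiff Topology ENNReal
open Filter Set Literature.Geometry.Lorentzian

namespace Summit.FinalStateConjecture.FinalStateConjecture.Theorems.NecksCertify.Negative

set_option linter.dupNamespace false

/-- **Hypothesis `H′` (physics-level; not constructible in the tree): a comoving pair with honest
charts exists.**  With `Hc`, `Hf`, `Sm` VERBATIM the three `let`-bound bundles of
`StarvedNecks.NecksCertify`: there are a connected `3`-manifold `X`, an admissible vacuum datum `D`
on it, a maximal vacuum Cauchy development `𝒟` of `D`, and a `C⁴` final-state decomposition `d` of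
`O = J⁺(ιX) ∩ I⁻(d.charted)` with `Hc ∧ Hf` at some `R₀` (the antecedent of `NecksCertify`), such
that EVERY `C²` final-state decomposition `d₂` of the same exterior with `Hc` at some `R₀'` and `Sm`
for some radii `R` has two distinct labels with the same asymptotic four-velocity `Λᵢ∂₀ = Λⱼ∂₀`.
This is `EqualVelocityBinaryWitness` (p73407) without the growth conjunct, which
`excision_tendsto_atTop_of_seamed` proves for every seamed output.  Intended inhabitant: a threshold
("parabolic") head-on two-black-hole recession — both holes asymptotically at the centre-of-mass
velocity, separation `∼ t^{2/3}` (sublinear drifts are admitted by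
`FinalStateDecomposition.tendsto_excision_div`); label rigidity of its honest seamed re-chartings
is the physics content.  Misses the planner's repair C′ (pairwise distinct asymptotic velocities
of the INPUT as an antecedent), see `Cruxes/NecksCertify/Restated.lean`.  Source of the witness:
item evidence EVIDENCE.md of `refuter-rattack-stmt-FinalStateConjecture-13549-0` (2026-08-15), §4;
Dafermos–Luk arXiv:1710.01722, §1.2.1 ("finitely many Kerr black holes moving away from each
other" — equal velocities are not excluded by the conjecture's wording).
[topic: Summits/FinalStateConjecture/FinalStateConjecture — multi-black-hole kinematics] -/
def ComovingPairWitness : Prop :=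
  open Literature.Geometry.Lorentzian in open scoped ContDiff ENNReal in let Hc := ( fun (𝓢 : Spacetime.{0} 4) (O : Set 𝓢.carrier) (k : ℕ) (d : FinalStateDecomposition 𝓢 O k) (R₀ : ℝ) => let B := d.background; let t := fun i ↦ (B i).time; let r := fun i ↦ (B i).radius; let Ψ := d.chart; (∀ i, Kerr.IsSubextremal (d.mass i) (d.spin i) ∧ 100 * d.mass i ≤ R₀ ∧ 0 < ((d.motion i).1 : E4 ≃L[ℝ] E4) (E4.basisVector 0) 0) ∧ (∀ i (ϱ τ₂ : ℝ), R₀ ≤ ϱ → d.τ₀ < τ₂ → Ψ i '' {x | d.τ₀ < t i x.1 ∧ t i x.1 < τ₂ ∧ r i x.1 < ϱ} ⊆ 𝓢.metric.causalPast 𝓢.timeOrientation (Ψ i '' (B i).truncTimeSlab ϱ τ₂)) ∧ (∀ i (τ' : ℝ) (ϱ : ℝ → ℝ), Continuous ϱ → d.τ₀ < τ' → let A := Ψ i '' {x | τ' ≤ t i x.1 ∧ r i x.1 ≤ ϱ (t i x.1)}; closure A ∩ O ⊆ A) ∧ (∀ y : d.flatDomain, d.τ₀ < y.1 0 → 𝓢.timeOrientation.IsFutureDirected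 (mfderiv 𝓘(ℝ, E4) (𝓡 4) d.flatChart y (E4.basisVector 0))) ); let Hf := ( fun (𝓢 : Spacetime.{0} 4) (O : Set 𝓢.carrier) (k : ℕ) (d : FinalStateDecomposition 𝓢 O k) (R₀ : ℝ) => let B := d.background; let t := fun i ↦ (B i).time; let r := fun i ↦ (B i).radius; let Φ := d.flatChart; (∀ τ₂ : ℝ, d.τ₀ < τ₂ → Φ '' {y | d.τ₀ < y.1 0 ∧ y.1 0 < τ₂} ⊆ 𝓢.metric.causalPast 𝓢.timeOrientation (Φ '' (Minkowski.backgroundOn d.flatDomain).timeSlab τ₂)) ∧ (∀ τ' : ℝ, d.τ₀ < τ' → closure (Φ '' {y | τ' ≤ y.1 0 ∧ ∀ i, d.excision i (y.1 0) + 1 ≤ r i y.1}) ⊆ Φ '' {y | τ' ≤ y.1 0}) ∧ (∀ i, ∃ T : ℝ, supCkENorm (Subtype.val '' {x : (B i).domain | T ≤ t i x.1 ∧ R₀ ≤ r i x.1 ∧ ∀ j, j ≠ i → r i x.1 ≤ r j x.1}) 0 (𝓢.deviationExtend (B i) (d.chart i)) ≤ ENNReal.ofReal (1 / (10 * ‖(((d.motion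 i).1 : E4 ≃L[ℝ] E4) : E4 →L[ℝ] E4)‖ ^ 2))) ); let Sm := ( fun (𝓢 : Spacetime.{0} 4) (O : Set 𝓢.carrier) (d : FinalStateDecomposition 𝓢 O 2) (R : Fin d.N → ℝ → ℝ) (R₀ : ℝ) => let B := d.background; let t := fun i ↦ (B i).time; let r := fun i ↦ (B i).radius; let Λ := fun i ↦ ((d.motion i).1 : E4 ≃L[ℝ] E4); let Φ := d.flatChart; let Ψ := d.chart; let ρ := d.excision; (∀ i, Monotone (R i) ∧ Continuous (R i) ∧ ∀ s, R₀ + 4 ≤ R i s ∧ R₀ ≤ ρ i s) ∧ (∀ i, Tendsto (fun τ ↦ 𝓢.truncDeviationCk (B i) (Ψ i) 2 (R i τ) τ) atTop (𝓝 0)) ∧ supCkENorm (Subtype.val '' {y : d.flatDomain | d.τ₀ ≤ y.1 0}) 0 (𝓢.deviationExtend (Minkowski.backgroundOn d.flatDomain) Φ) ≤ 10⁻¹ ∧ (∀ i, supCkENorm (Subtype.val '' {x : (B i).domain | (d.τ₀ ≤ t i x.1 ∨ d.τ₀ ≤ x.1 0) ∧ R₀ ≤ r i x.1 ∧ r i x.1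 ≤ R i (t i x.1)}) 0 (𝓢.deviationExtend (B i) (Ψ i)) ≤ ENNReal.ofReal (1 / (10 * ‖(Λ i : E4 →L[ℝ] E4)‖ ^ 2))) ∧ (∀ i (x : (B i).domain), (d.τ₀ ≤ t i x.1 ∨ d.τ₀ ≤ x.1 0) → R₀ ≤ r i x.1 → r i x.1 ≤ R i (t i x.1) → 𝓢.timeOrientation.IsFutureDirected (mfderiv 𝓘(ℝ, E4) (𝓡 4) (Ψ i) x ((Λ i) (E4.basisVector 0)))) ∧ (∀ i (y : E4) (hy : y ∈ (B i).domain), d.τ₀ ≤ y 0 → (∀ j, ρ j (y 0) < r j y) → r i y ≤ R i (t i y) + 1 → ∃ hy' : y ∈ d.flatDomain, Ψ i ⟨y, hy⟩ = Φ ⟨y, hy'⟩) ∧ (∀ y : d.flatDomain, d.τ₀ ≤ y.1 0 → ∀ j, ρ j (y.1 0) < r j y.1) ∧ (∀ j (y : E4), d.τ₀ ≤ y 0 → r j y ≤ ρ j (y 0) → r j y + 2 ≤ R j (t j y)) ∧ (∀ j (y : E4), d.τ₀ ≤ t j y → r j y ≤ R j (t j y) + 2 → t j y ≤ y 0) ∧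 (∀ j, Ψ j '' {x | d.τ₀ < t j x.1 ∧ R j (t j x.1) + 1 < r j x.1} ⊆ d.radiationZone) ∧ (∀ τ' : ℝ, d.τ₀ < τ' → closure (Φ '' {y | τ' ≤ y.1 0}) ⊆ Φ '' {y | τ' ≤ y.1 0} ∪ ⋃ j, Ψ j '' {x | τ' ≤ x.1 0 ∧ r j x.1 = ρ j (x.1 0)}) ∧ (∀ j j' (y : E4), j ≠ j' → (d.τ₀ ≤ y 0 ∨ d.τ₀ ≤ t j y) → r j y ≤ R j (t j y) + 1 → R j' (t j' y) + 1 < r j' y) ); ∃ (X : Type) (_ : TopologicalSpace X) (_ : ChartedSpace E3 X) (_ : IsManifold (𝓡 3) ∞ X) (_ : ConnectedSpace X) (D : InitialDataSet (𝓡 3) X) (_ : D ∈ admissibleVacuumData X) (𝒟 : VacuumCauchyDevelopment D) (_ : 𝒟.IsMaximal) (O : Set 𝒟.carrier) (d : FinalStateDecomposition 𝒟.toSpacetime O 4) (R₀ : ℝ), O = exteriorOf 𝒟.toCauchyDevelopment d.charted ∧ Hc 𝒟.toSpacetime O 4 d R₀ ∧ Hf 𝒟.toSpacetime O 4 d R₀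 ∧ ∀ (d₂ : FinalStateDecomposition 𝒟.toSpacetime O 2) (R : Fin d₂.N → ℝ → ℝ) (R₀' : ℝ), O = exteriorOf 𝒟.toCauchyDevelopment d₂.charted → Hc 𝒟.toSpacetime O 2 d₂ R₀' → Sm 𝒟.toSpacetime O d₂ R R₀' → ∃ i j : Fin d₂.N, i ≠ j ∧ ((d₂.motion i).1 : E4 ≃L[ℝ] E4) (E4.basisVector 0) = ((d₂.motion j).1 : E4 ≃L[ℝ] E4) (E4.basisVector 0)

/-- `H → H′`: the landed equal-velocity binary witness (p73407) is in particular a comoving pair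
witness (drop the growth conjunct). -/
theorem comovingPairWitness_of_equalVelocityBinaryWitness (hH : EqualVelocityBinaryWitness) :
    ComovingPairWitness := by
  obtain ⟨X, i₁, i₂, i₃, i₄, D, hD, 𝒟, h𝒟, O, d, R₀, hO, hc, hf, hW⟩ := hH
  exact ⟨X, i₁, i₂, i₃, i₄, D, hD, 𝒟, h𝒟, O, d, R₀, hO, hc, hf,
    fun d₂ R R₀' hO₂ hc₂ hsm ↦ (hW d₂ R R₀' hO₂ hc₂ hsm).1⟩

/-- **`¬ NecksCertify` modulo `H′ = ComovingPairWitness`** (negative lemma modulo `H′`; the crux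
item stays open, held on `H′`).  Proof: apply the crux to the honest `C⁴` input of `H′`; the
resulting honest-core, seamed `C²` decomposition `d₂` has `R ≥ R₀' + 4 ≥ 100·Mᵢ + 4 > −1` (S1,
`Hc`(1)), a comoving pair `i ≠ j` (by `H′`), and — this is the new input — UNBOUNDED excision
radius `ρⱼ → ∞` by `excision_tendsto_atTop_of_seamed` from `Hc`(1), S1, S6, S7, S8, S12 of `d₂`;
`false_of_parallel_boosts_of_tendsto` (S8 + S12) closes. -/
theorem NecksCertify_false_of_ComovingPairWitness (hH : ComovingPairWitness) :
    ¬ Theses.StarvedNecks.NecksCertify := by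
  intro hS
  obtain ⟨X, _, _, _, _, D, hD, 𝒟, h𝒟, O, d, R₀, hO, hc, hf, hW⟩ := hH
  obtain ⟨d₂, R, R₀', hO₂, hc₂, hsm⟩ := hS X D hD 𝒟 h𝒟 O d R₀ hO hc hf
  obtain ⟨i, j, hij, hpar⟩ := hW d₂ R R₀' hO₂ hc₂ hsm
  obtain ⟨h1, -, -, -, -, h6, h7, h8, -, -, -, h12⟩ := hsm
  have hgrow : Tendsto (d₂.excision j) atTop atTop :=
    excision_tendsto_atTop_of_seamed d₂ R R₀' hc₂.1
      (fun i ↦ ⟨(h1 i).2.1, fun s ↦ ((h1 i).2.2 s).2⟩) h6 h7 h8 h12 j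
  have hR₀' : 0 ≤ R₀' := by
    have ha := (hc₂.1 i).2.1
    have hb := d₂.mass_pos i
    linarith
  exact false_of_parallel_boosts_of_tendsto d₂ R
    (fun j s ↦ by linarith [((h1 j).2.2 s).1]) h8 h12 hij hpar hgrow

/-- The landed `H` also refutes the crux through `H′` (sanity composition of the two files). -/
example (hH : EqualVelocityBinaryWitness) : ¬ Theses.StarvedNecks.NecksCertify :=
  NecksCertify_false_of_ComovingPairWitness (comovingPairWitness_of_equalVelocityBinaryWitness hH)

/-- **Conversely, `¬ NecksCertify → H′`**: a failing honest input has no honest-core seamed output at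
all, so the universal clause of `H′` holds vacuously.  Recorded for honesty about what the hold means:
`H′` carries NO content beyond `¬ NecksCertify` — it is the WEAKEST hypothesis a negative lemma for this
crux can have (see `comovingPairWitness_iff_not_necksCertify`), phrased so that its intended inhabitant
(a threshold two-hole recession with honest charts) and the mechanism that kills its re-chartings
(G1 + S8 + S12) are visible.  Constructing `H′` IS refuting the crux as filed; the recorded repair is
therefore to RESTATE the item (C′, `Cruxes/NecksCertify/Restated.lean`), not to wait for `H′`. -/
theorem comovingPairWitness_of_not_necksCertify (h : ¬ Theses.StarvedNecks.NecksCertify) :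
    ComovingPairWitness := by
  by_contra hH
  apply h
  intro X i₁ i₂ i₃ i₄ D hD 𝒟 h𝒟 O d R₀ hO hc hf
  by_contra hno
  exact hH ⟨X, i₁, i₂, i₃, i₄, D, hD, 𝒟, h𝒟, O, d, R₀, hO, hc, hf,
    fun d₂ R R₀' hO₂ hc₂ hsm ↦ (hno ⟨d₂, R, R₀', hO₂, hc₂, hsm⟩).elim⟩

/-- **`H′ ↔ ¬ NecksCertify`.**  The comoving-pair witness is exactly the failure of the crux as filed
(forward: G1 + S8 + S12; backward: vacuity).  So the crux AS FILED is refuted by, and only by, a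
two-black-hole MGHD with honest `C⁴` charts admitting no honest-core seamed `C²` re-charting — the
threshold ("parabolic") recession being the expected one — and is repaired by excluding such inputs
(C′: pairwise distinct asymptotic velocities of the input). -/
theorem comovingPairWitness_iff_not_necksCertify :
    ComovingPairWitness ↔ ¬ Theses.StarvedNecks.NecksCertify :=
  ⟨NecksCertify_false_of_ComovingPairWitness, comovingPairWitness_of_not_necksCertify⟩

/-- **Every seamed honest-core output has pairwise distinct labels** (the positive-side reading of
G1 + S8 + S12, stated clause-wise like `excision_tendsto_atTop_of_seamed` so that seam / N2 provers
and the planner's restatement can cite it): for a `C²` final-state decomposition `d` with radii `R`,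
`R₀` satisfying `Hc`(1), S1 (continuity of `Rᵢ`, `Rᵢ ≥ R₀ + 4`, `ρᵢ ≥ R₀`), S6, S7, S8 and S12 of
the crux's `Sm`, the asymptotic four-velocities `Λᵢ∂₀` are pairwise distinct.  Proof: a parallel
pair `i ≠ j` plus `ρⱼ → ∞` (G1) contradicts `false_of_parallel_boosts_of_tendsto`; `R ≥ −1` from
`Rᵢ ≥ R₀ + 4` and `R₀ ≥ 100·Mᵢ > 0`. -/
theorem pairwise_ne_of_seamed {𝓢 : Spacetime.{0} 4} {O : Set 𝓢.carrier}
    (d : FinalStateDecomposition 𝓢 O 2) (R : Fin d.N → ℝ → ℝ) (R₀ : ℝ)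
    (hc1 : ∀ i, Kerr.IsSubextremal (d.mass i) (d.spin i) ∧ 100 * d.mass i ≤ R₀ ∧
      0 < ((d.motion i).1 : E4 ≃L[ℝ] E4) (E4.basisVector 0) 0)
    (S1 : ∀ i, Continuous (R i) ∧ ∀ s, R₀ + 4 ≤ R i s ∧ R₀ ≤ d.excision i s)
    (S6 : ∀ i (y : E4) (hy : y ∈ (d.background i).domain), d.τ₀ ≤ y 0 →
      (∀ j, d.excision j (y 0) < (d.background j).radius y) →
      (d.background i).radius y ≤ R i ((d.background i).time y) + 1 →
      ∃ hy' : y ∈ d.flatDomain, d.chart i ⟨y, hy⟩ = d.flatChart ⟨y, hy'⟩)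
    (S7 : ∀ y : d.flatDomain, d.τ₀ ≤ y.1 0 → ∀ j, d.excision j (y.1 0) < (d.background j).radius y.1)
    (S8 : ∀ j (y : E4), d.τ₀ ≤ y 0 → (d.background j).radius y ≤ d.excision j (y 0) →
      (d.background j).radius y + 2 ≤ R j ((d.background j).time y))
    (S12 : ∀ j j' (y : E4), j ≠ j' → (d.τ₀ ≤ y 0 ∨ d.τ₀ ≤ (d.background j).time y) →
      (d.background j).radius y ≤ R j ((d.background j).time y) + 1 →
      R j' ((d.background j').time y) + 1 < (d.background j').radius y) :
    ∀ i j : Fin d.N, i ≠ j →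
      ((d.motion i).1 : E4 ≃L[ℝ] E4) (E4.basisVector 0) ≠
        ((d.motion j).1 : E4 ≃L[ℝ] E4) (E4.basisVector 0) := by
  intro i j hij hpar
  have hgrow : Tendsto (d.excision j) atTop atTop :=
    excision_tendsto_atTop_of_seamed d R R₀ hc1 (fun i ↦ ⟨(S1 i).1, fun s ↦ ((S1 i).2 s).2⟩)
      S6 S7 S8 S12 j
  have hR₀ : 0 ≤ R₀ := by
    have ha := (hc1 i).2.1
    have hb := d.mass_pos i
    linarith
  exact false_of_parallel_boosts_of_tendsto d R (fun j s ↦ by linarith [((S1 j).2 s).1]) S8 S12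
    hij hpar hgrow

/-- `NecksCertify → ¬ H′` (contrapositive packaging of the negative lemma). -/
theorem not_comovingPairWitness_of_necksCertify (h : Theses.StarvedNecks.NecksCertify) :
    ¬ ComovingPairWitness :=
  fun hH ↦ NecksCertify_false_of_ComovingPairWitness hH h

end Summit.FinalStateConjecture.FinalStateConjecture.Theorems.NecksCertify.Negative

end
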